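import Mathlib
import Literature.Analysis.FluidPDE.Tao2016AveragedNS.ShiftSetCascadeFlows
import HarnessLib

/-!
# The renormalised (homogeneous) frame of the cascade lattice on a shift set `𝕊`
  (helper for item stmt-NavierStokesRegularity-22987 `FlatGapCertificatesV2`, crux K_A♭ of route
  TaoLadderRungTwoFlat; cell harvest/h2-tao-ladder, p1 g19)

Tao's nonlinearity (4.8) on a shift set `𝕊` carries the clock `c_{n-μ₃} = (1+ε₀)^{5(n-μ₃)/2}` of the
triad's base shell. In the AMPLITUDE-RENORMALISED variables `U_{i,k} := c_k · X_{i,k}` the lattice is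
TRANSLATION INVARIANT in the shell index: `c_n · quadTermOn 𝕊 ε₀ α X i n = quadTermOn 𝕊 0 α̃ U i n` with the
k-INDEPENDENT renormalised table `α̃(μ) := α(μ) · (1+ε₀)^{(5/2)(μ₃ − μ₁ − μ₂)}` (`renormTable`). So the graded
lattice at scale ratio `1+ε₀` IS the homogeneous lattice (ratio `0`) of an `O(ε₀)`-perturbation of the table:
on `S♭` the factors are `1` on `(0,0,0), (1,0,1), (0,1,1)`, `(1+ε₀)^{-5/2}` on `(1,0,0), (0,1,0)`,
`(1+ε₀)^{5/2}` on `(0,0,1)` and `(1+ε₀)^{-5}` on `(1,1,0)`. This is the frame in which the `ε₀ → 0` end of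
K_A♭ (which, as typed, asks for SOME `ε_s > 0` only) is a regular one-parameter perturbation problem about the
homogeneous lattice; the shell-vector form of the same frame on Tao's `S` is theory-2's renormalised lattice
(`Literature…RenormalisedCascadeWaves`, feed `Λ·A`, drain `Λ⁻¹·B`); here it is stated for a general shift
set and for the scalar families / `PseudoFlowOnShift` format of the certificates.

Contents: `clockW`, `renormTable`, `renormFam`, `renormState`, `renormEnergy`; the algebraic identity
`clockW_mul_quadTermOn`; the transport of EXACT (defect-free, zero-slack) `PseudoFlowOnShift 𝕊` flows at
ratio `1+ε₀` to exact flows of the renormalised table at ratio `0` (`pseudoFlowOnShift_renorm`). The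
renormalised table is symmetric but NOT cancelling (the conserved energy becomes `Σ c_k⁻² U_k²`); it is an
analysis device, never a witness table.

HONEST FRAMING: change-of-variables identities about a MODEL lattice (Tao 2016 §4 vocabulary, shift-set
parametrised); nothing is certified here and nothing is a statement about the Navier–Stokes equations.
-/

noncomputable section

-- the sub-problem namespace repeats the summit name by design (D-0017)
set_option linter.dupNamespace false

namespace Summit.NavierStokesRegularity.NavierStokesRegularity.Theorems

open Set Literature.Analysis.FluidPDE Literature.Analysis.FluidPDE.TaoCascade

namespace RenormFrame

variable {m : ℕ}

/-- The shell clock `c_k = (1+ε₀)^{5k/2}` of Tao's cascade (4.8).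
[cite: Tao2016AveragedNS, §4 (4.8) (the factor `(1+ε₀)^{5n/2}`)] -/
def clockW (ε₀ : ℝ) (k : ℤ) : ℝ := (1 + ε₀) ^ ((5 : ℝ) * k / 2)

/-- The RENORMALISED TABLE `α̃(μ) = α(μ)·(1+ε₀)^{(5/2)(μ₃−μ₁−μ₂)}` — shell independent; at `ε₀ = 0` it is `α`.
[cite: Tao2016AveragedNS, §4 (4.8) and §6.4 (the rescaled system); cell harvest/h2-tao-ladder, renormalised frame] -/
def renormTable (ε₀ : ℝ) (α : Fin m → Fin m → Fin m → ℤ × ℤ × ℤ → ℝ) :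
    Fin m → Fin m → Fin m → ℤ × ℤ × ℤ → ℝ :=
  fun i₁ i₂ i₃ μ => α i₁ i₂ i₃ μ * (1 + ε₀) ^ ((5 : ℝ) * (μ.2.2 - μ.1 - μ.2.1) / 2)

/-- The renormalised amplitudes `U_{i,k}(t) = c_k · X_{i,k}(t)`.
[cite: Tao2016AveragedNS, §6.4 (rescaled amplitudes); cell harvest/h2-tao-ladder, renormalised frame] -/
def renormFam (ε₀ : ℝ) (X : Fin m → ℤ → ℝ → ℝ) : Fin m → ℤ → ℝ → ℝ :=
  fun i k t => clockW ε₀ k * X i k t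

/-- The renormalised state `c_k · S₀_{i,k}`. [cite: Tao2016AveragedNS, §6.4; cell harvest/h2-tao-ladder, renormalised frame] -/
def renormState (ε₀ : ℝ) (S₀ : Fin m → ℤ → ℝ) : Fin m → ℤ → ℝ :=
  fun i k => clockW ε₀ k * S₀ i k

/-- The renormalised energies `c_k² · F_{i,k}(t)`. [cite: Tao2016AveragedNS, §6.4 (rescaled energies); cell harvest/h2-tao-ladder, renormalised frame] -/
def renormEnergy (ε₀ : ℝ) (F : Fin m → ℤ → ℝ → ℝ) : Fin m → ℤ → ℝ → ℝ :=
  fun i k t => clockW ε₀ k ^ 2 * F i k t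

/-- The clock is positive for `ε₀ > -1`. [cite: Tao2016AveragedNS, §4 (4.8)] -/
theorem clockW_pos {ε₀ : ℝ} (hε : -1 < ε₀) (k : ℤ) : 0 < clockW ε₀ k :=
  Real.rpow_pos_of_pos (by linarith) _

/-- At ratio `0` every clock is `1`. [cite: Tao2016AveragedNS, §4 (4.8)] -/
@[simp] theorem clockW_zero (k : ℤ) : clockW 0 k = 1 := by
  simp [clockW]

/-- At ratio `0` the renormalised table is the table. [cite: Tao2016AveragedNS, §4 (4.8)] -/
@[simp] theorem renormTable_zero (α : Fin m → Fin m → Fin m → ℤ × ℤ × ℤ → ℝ) : renormTable 0 α = α := by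
  funext i₁ i₂ i₃ μ
  simp [renormTable]

/-- The clock satisfies `c_k ≤ 1 + (1+ε₀)^{10k}` for `ε₀ ≥ 0` (so renormalisation keeps the a-priori bound (4.5)).
[cite: Tao2016AveragedNS, §4 (4.5)] -/
theorem clockW_le_one_add {ε₀ : ℝ} (hε : 0 ≤ ε₀) (k : ℤ) :
    clockW ε₀ k ≤ 1 + (1 + ε₀) ^ ((10 : ℝ) * k) := by
  have hL : (1 : ℝ) ≤ 1 + ε₀ := by linarith
  have hpos : (0 : ℝ) < (1 + ε₀) ^ ((10 : ℝ) * k) := Real.rpow_pos_of_pos (by linarith) _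
  unfold clockW
  rcases le_or_gt 0 k with hk | hk
  · have hk' : (0 : ℝ) ≤ k := by exact_mod_cast hk
    have : (1 + ε₀) ^ ((5 : ℝ) * k / 2) ≤ (1 + ε₀) ^ ((10 : ℝ) * k) :=
      Real.rpow_le_rpow_of_exponent_le hL (by nlinarith)
    linarith
  · have hk' : (k : ℝ) < 0 := by exact_mod_cast hk
    have : (1 + ε₀) ^ ((5 : ℝ) * k / 2) ≤ 1 :=
      Real.rpow_le_one_of_one_le_of_nonpos hL (by nlinarith)
    linarith

/-- Exponent bookkeeping: `c_n · c_{n−μ₃} = (1+ε₀)^{(5/2)(μ₃−μ₁−μ₂)} · c_{n−μ₃+μ₁} · c_{n−μ₃+μ₂}`.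
[cite: Tao2016AveragedNS, §4 (4.8)] -/
theorem clock_product {ε₀ : ℝ} (hε : -1 < ε₀) (n μ₁ μ₂ μ₃ : ℤ) :
    (1 + ε₀) ^ ((5 : ℝ) * n / 2) * (1 + ε₀) ^ ((5 : ℝ) * ((n - μ₃ : ℤ) : ℝ) / 2) =
      (1 + ε₀) ^ ((5 : ℝ) * (μ₃ - μ₁ - μ₂) / 2) *
        ((1 + ε₀) ^ ((5 : ℝ) * ((n - μ₃ + μ₁ : ℤ) : ℝ) / 2) *
          (1 + ε₀) ^ ((5 : ℝ) * ((n - μ₃ + μ₂ : ℤ) : ℝ) / 2)) := by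
  have hL : (0 : ℝ) < 1 + ε₀ := by linarith
  rw [← Real.rpow_add hL, ← Real.rpow_add hL, ← Real.rpow_add hL]
  congr 1
  push_cast
  ring

/-- **THE RENORMALISED FRAME.** `c_n · quadTermOn 𝕊 ε₀ α X i n t = quadTermOn 𝕊 0 (renormTable ε₀ α) (renormFam ε₀ X) i n t`:
in the variables `U = c·X` the graded lattice is the homogeneous (ratio-`0`) lattice of the shell-independent table `α̃`.
[cite: Tao2016AveragedNS, §4 (4.8) and §6.4 (the rescaled system); cell harvest/h2-tao-ladder, renormalised frame] -/
theorem clockW_mul_quadTermOn {ε₀ : ℝ} (hε : -1 < ε₀) (𝕊 : Finset (ℤ × ℤ × ℤ))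
    (α : Fin m → Fin m → Fin m → ℤ × ℤ × ℤ → ℝ) (X : Fin m → ℤ → ℝ → ℝ) (i : Fin m) (n : ℤ) (t : ℝ) :
    clockW ε₀ n * quadTermOn 𝕊 ε₀ α X i n t =
      quadTermOn 𝕊 0 (renormTable ε₀ α) (renormFam ε₀ X) i n t := by
  simp only [quadTermOn, renormTable, renormFam, clockW, Finset.mul_sum, add_zero, Real.one_rpow, mul_one]
  refine Finset.sum_congr rfl fun i₁ _ => Finset.sum_congr rfl fun i₂ _ => Finset.sum_congr rfl fun μ _ => ?_
  have h := clock_product hε n μ.1 μ.2.1 μ.2.2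
  have e1 : ((n - μ.2.2 : ℤ) : ℝ) = (n : ℝ) - μ.2.2 := by push_cast; ring
  rw [e1] at h
  calc (1 + ε₀) ^ ((5 : ℝ) * n / 2) *
        (α i₁ i₂ i μ * (1 + ε₀) ^ ((5 : ℝ) * (n - μ.2.2) / 2) *
          (X i₁ (n - μ.2.2 + μ.1) t * X i₂ (n - μ.2.2 + μ.2.1) t))
      = α i₁ i₂ i μ * ((1 + ε₀) ^ ((5 : ℝ) * n / 2) * (1 + ε₀) ^ ((5 : ℝ) * (n - μ.2.2) / 2)) *
          (X i₁ (n - μ.2.2 + μ.1) t * X i₂ (n - μ.2.2 + μ.2.1) t) := by ring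
    _ = α i₁ i₂ i μ * ((1 + ε₀) ^ ((5 : ℝ) * (μ.2.2 - μ.1 - μ.2.1) / 2) *
          ((1 + ε₀) ^ ((5 : ℝ) * ((n - μ.2.2 + μ.1 : ℤ) : ℝ) / 2) *
            (1 + ε₀) ^ ((5 : ℝ) * ((n - μ.2.2 + μ.2.1 : ℤ) : ℝ) / 2))) *
          (X i₁ (n - μ.2.2 + μ.1) t * X i₂ (n - μ.2.2 + μ.2.1) t) := by rw [h]
    _ = α i₁ i₂ i μ * (1 + ε₀) ^ ((5 : ℝ) * (μ.2.2 - μ.1 - μ.2.1) / 2) *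
          ((1 + ε₀) ^ ((5 : ℝ) * ((n - μ.2.2 + μ.1 : ℤ) : ℝ) / 2) * X i₁ (n - μ.2.2 + μ.1) t *
            ((1 + ε₀) ^ ((5 : ℝ) * ((n - μ.2.2 + μ.2.1 : ℤ) : ℝ) / 2) * X i₂ (n - μ.2.2 + μ.2.1) t)) := by
          ring

/-- The inverse reading: `quadTermOn 𝕊 ε₀ α X i n t = c_n⁻¹ · quadTermOn 𝕊 0 α̃ U i n t`.
[cite: Tao2016AveragedNS, §4 (4.8) and §6.4; cell harvest/h2-tao-ladder, renormalised frame] -/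
theorem quadTermOn_eq_inv_clockW_mul {ε₀ : ℝ} (hε : -1 < ε₀) (𝕊 : Finset (ℤ × ℤ × ℤ))
    (α : Fin m → Fin m → Fin m → ℤ × ℤ × ℤ → ℝ) (X : Fin m → ℤ → ℝ → ℝ) (i : Fin m) (n : ℤ) (t : ℝ) :
    quadTermOn 𝕊 ε₀ α X i n t =
      (clockW ε₀ n)⁻¹ * quadTermOn 𝕊 0 (renormTable ε₀ α) (renormFam ε₀ X) i n t := by
  rw [← clockW_mul_quadTermOn hε, ← mul_assoc, inv_mul_cancel₀ (clockW_pos hε n).ne', one_mul]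

/-- The renormalised table is symmetric on `𝕊` when `α` is (the factor is symmetric in `μ₁, μ₂`).
[cite: Tao2016AveragedNS, §4 (4.2)] -/
theorem isSymmetricCoeffOn_renormTable {𝕊 : Finset (ℤ × ℤ × ℤ)} {α : Fin m → Fin m → Fin m → ℤ × ℤ × ℤ → ℝ}
    (h : IsSymmetricCoeffOn 𝕊 α) (ε₀ : ℝ) : IsSymmetricCoeffOn 𝕊 (renormTable ε₀ α) := by
  intro i₁ i₂ i₃ μ₁ μ₂ μ₃ hμ
  simp only [renormTable]
  rw [h i₁ i₂ i₃ μ₁ μ₂ μ₃ hμ]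
  ring_nf

/-- The renormalised table is supported on `𝕊` when `α` is. [cite: Tao2016AveragedNS, §4 (4.1)] -/
theorem renormTable_eq_zero_of_not_mem {𝕊 : Finset (ℤ × ℤ × ℤ)} {R : ℝ}
    {α : Fin m → Fin m → Fin m → ℤ × ℤ × ℤ → ℝ} (h : IsComparableCoeffOn 𝕊 R α) (ε₀ : ℝ)
    (i₁ i₂ i₃ : Fin m) {μ : ℤ × ℤ × ℤ} (hμ : μ ∉ 𝕊) : renormTable ε₀ α i₁ i₂ i₃ μ = 0 := by
  simp [renormTable, h.2 i₁ i₂ i₃ μ hμ]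

/-- Entry size of the renormalised table: `|α̃(μ)| = |α(μ)| · (1+ε₀)^{(5/2)(μ₃−μ₁−μ₂)}` (`ε₀ > -1`).
[cite: Tao2016AveragedNS, §4 (4.8)] -/
theorem abs_renormTable {ε₀ : ℝ} (hε : -1 < ε₀) (α : Fin m → Fin m → Fin m → ℤ × ℤ × ℤ → ℝ)
    (i₁ i₂ i₃ : Fin m) (μ : ℤ × ℤ × ℤ) :
    |renormTable ε₀ α i₁ i₂ i₃ μ| = |α i₁ i₂ i₃ μ| * (1 + ε₀) ^ ((5 : ℝ) * (μ.2.2 - μ.1 - μ.2.1) / 2) := by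
  rw [renormTable, abs_mul, abs_of_pos (Real.rpow_pos_of_pos (by linarith) _)]

/-! ### Transport of exact flows -/

/-- `derivWithin` of a constant multiple on `[0, τ]`. [folklore] -/
theorem derivWithin_const_mul_Icc {f : ℝ → ℝ} {τ : ℝ} (c : ℝ) (hf : ContDiffOn ℝ 1 f (Icc 0 τ))
    {s : ℝ} (hs : s ∈ Icc 0 τ) :
    derivWithin (fun t => c * f t) (Icc 0 τ) s = c * derivWithin f (Icc 0 τ) s :=
  derivWithin_const_mul c (hf.differentiableOn_one s hs)

/-- **TRANSPORT OF EXACT FLOWS TO THE RENORMALISED FRAME.** An exact (defect-free, zero-slack, start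
energies `½S₀²`) `PseudoFlowOnShift 𝕊` flow at scale ratio `1+ε₀`, `ε₀ ≥ 0`, on `[0, τ]` becomes, in the
variables `U = c·S`, `G = c²·F`, an exact flow AT RATIO `0` of the renormalised table from the renormalised
start state. (Qualitative a-priori bounds transfer because `c_k ≤ 1 + (1+ε₀)^{10k}`.)
[cite: Tao2016AveragedNS, §4 Lemma 4.1 (4.5), (4.8)–(4.10) and §6.4 Prop. 6.5 (the rescaled system); cell harvest/h2-tao-ladder, renormalised frame] -/
theorem pseudoFlowOnShift_renorm {𝕊 : Finset (ℤ × ℤ × ℤ)} {τ ε₀ : ℝ} (hε : 0 ≤ ε₀)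
    {α : Fin m → Fin m → Fin m → ℤ × ℤ × ℤ → ℝ} {S₀ : Fin m → ℤ → ℝ} {S F : Fin m → ℤ → ℝ → ℝ}
    (h : PseudoFlowOnShift 𝕊 τ ε₀ α 0 0 S₀ (fun i k => (1 / 2) * S₀ i k ^ 2) (fun _ _ => 0) S F) :
    PseudoFlowOnShift 𝕊 τ 0 (renormTable ε₀ α) 0 0 (renormState ε₀ S₀)
      (fun i k => (1 / 2) * renormState ε₀ S₀ i k ^ 2) (fun _ _ => 0) (renormFam ε₀ S) (renormEnergy ε₀ F) := by
  have hε' : (-1 : ℝ) < ε₀ := by linarith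
  have hc : ∀ k, 0 < clockW ε₀ k := clockW_pos hε'
  refine
    { contDiffOn_S := fun i k => contDiffOn_const.mul (h.contDiffOn_S i k)
      contDiffOn_F := fun i k => contDiffOn_const.mul (h.contDiffOn_F i k)
      nonneg_F := fun i k s hs => mul_nonneg (sq_nonneg _) (h.nonneg_F i k s hs)
      apriori_S := ?_
      apriori_F := ?_
      init_S := fun i k => by simp [renormFam, renormState, h.init_S i k]
      init_F := fun i k => by simp only [renormEnergy, renormState, h.init_F i k]; ring
      motion := ?_
      energy := ?_
      defect_lower := ?_
      defect_upper := ?_ }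
  · -- (4.5), amplitudes
    obtain ⟨M, hM⟩ := h.apriori_S
    refine ⟨2 * M, fun s hs i k => ?_⟩
    have hb := hM s hs i k
    have hcl := clockW_le_one_add hε k
    have hw : (0 : ℝ) ≤ (1 + ε₀) ^ ((10 : ℝ) * k) := (Real.rpow_pos_of_pos (by linarith) _).le
    simp only [renormFam, add_zero, Real.one_rpow, abs_mul, abs_of_pos (hc k)]
    have : clockW ε₀ k * |S i k s| ≤ (1 + (1 + ε₀) ^ ((10 : ℝ) * k)) * |S i k s| :=
      mul_le_mul_of_nonneg_right hcl (abs_nonneg _)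
    linarith
  · -- (4.5), energies
    obtain ⟨M, hM⟩ := h.apriori_F
    refine ⟨2 * M, fun s hs i k => ?_⟩
    have hb := hM s hs i k
    have hcl := clockW_le_one_add hε k
    have hF := h.nonneg_F i k s hs
    have hw : (0 : ℝ) ≤ (1 + ε₀) ^ ((10 : ℝ) * k) := (Real.rpow_pos_of_pos (by linarith) _).le
    have hsq : Real.sqrt (renormEnergy ε₀ F i k s) = clockW ε₀ k * Real.sqrt (F i k s) := by
      simp only [renormEnergy]
      rw [Real.sqrt_mul (sq_nonneg _), Real.sqrt_sq (hc k).le]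
    simp only [add_zero, Real.one_rpow, hsq]
    have : clockW ε₀ k * Real.sqrt (F i k s) ≤ (1 + (1 + ε₀) ^ ((10 : ℝ) * k)) * Real.sqrt (F i k s) :=
      mul_le_mul_of_nonneg_right hcl (Real.sqrt_nonneg _)
    linarith
  · -- (4.8), exact
    intro i k s hs
    have hm := h.motion i k s hs
    simp only [zero_mul] at hm
    have heq : derivWithin (S i k) (Icc 0 τ) s = quadTermOn 𝕊 ε₀ α S i k s := by
      have := abs_nonpos_iff.mp hm
      linarith
    have hd : derivWithin (renormFam ε₀ S i k) (Icc 0 τ) s = clockW ε₀ k * derivWithin (S i k) (Icc 0 τ) s :=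
      derivWithin_const_mul_Icc (clockW ε₀ k) (h.contDiffOn_S i k) hs
    rw [hd, heq, clockW_mul_quadTermOn hε', sub_self, abs_zero, zero_mul, zero_mul]
  · -- (4.9)
    intro i k s hs
    have he := h.energy i k s hs
    have hd : derivWithin (renormEnergy ε₀ F i k) (Icc 0 τ) s =
        clockW ε₀ k ^ 2 * derivWithin (F i k) (Icc 0 τ) s :=
      derivWithin_const_mul_Icc (clockW ε₀ k ^ 2) (h.contDiffOn_F i k) hs
    rw [hd, ← clockW_mul_quadTermOn hε']
    have h2 : 0 ≤ clockW ε₀ k ^ 2 := sq_nonneg _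
    calc clockW ε₀ k ^ 2 * derivWithin (F i k) (Icc 0 τ) s
        ≤ clockW ε₀ k ^ 2 * (quadTermOn 𝕊 ε₀ α S i k s * S i k s) := mul_le_mul_of_nonneg_left he h2
      _ = clockW ε₀ k * quadTermOn 𝕊 ε₀ α S i k s * renormFam ε₀ S i k s := by
          simp only [renormFam]; ring
  · -- (4.10), lower
    intro i k s hs
    have hl := h.defect_lower i k s hs
    simp only [renormFam, renormEnergy]
    have h2 : 0 ≤ clockW ε₀ k ^ 2 := sq_nonneg _
    nlinarith
  · -- (4.10), upper (zero slack, zero defect)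
    intro i k s hs
    have hu := h.defect_upper i k s hs
    simp only [zero_mul, add_zero] at hu
    simp only [renormFam, renormEnergy, zero_mul, add_zero]
    have h2 : 0 ≤ clockW ε₀ k ^ 2 := sq_nonneg _
    nlinarith

end RenormFrame

end Summit.NavierStokesRegularity.NavierStokesRegularity.Theorems

end
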